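import Mathlib
import Summits.AtomisticToContinuum.HydrodynamicLimit.Theorems.InformationPercolationEngineKickFairRelEquilibriumMesoConditionThePastDefs
import HarnessLib

/-!
# `KickFairRelEquilibriumMeso`, line `condition-the-past` — registered sub-goal PE″ `stub_pairExpansion2`:
# the abstract pair expansion with the pull-out on the JOIN (pure measure theory)

Prover file (`--supports stmt-AtomisticToContinuum-15177`, wave 2, lead c7) for the registered sub-goal
`stub_pairExpansion2 : PairExpansion2` (`…ConditionThePastDefs`, rev 2) of the line `condition-the-past` of the crux
`Summit.AtomisticToContinuum.HydrodynamicLimit.Theses.InformationPercolationEngine.KickFairRelEquilibriumMeso`.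

Setting: a finite measure `μ` on `(Ω, m0)`, a finite index type `K`; for each `k` a sub-σ-algebra `m k ≤ m0`,
for each pair an enlarged one `mA k l ≤ m0` with `m k, m l ≤ mA k l`; integrable outcomes `D k` with
`|D k| ≤ B` a.e.; weights `w k`, `m k`-measurable, `|w k| ≤ 1_{v k}` with `v k ∈ m k`; order events
`o k l, o l k ∈ mA k l`. Write `β k = μ[D k | m k]`, `ξ k = D k − β k`, `U k = w k ξ k`.

Claim (PE″): `∫ (Σ_k U_k)² dμ ≤ 2 Σ_k Σ_l ∫ 1_{v k ∩ v l ∩ o k l} |μ[ξ k ξ l | mA k l]| dμ`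
`+ 4B² Σ_k Σ_l μ(v k ∩ v l ∩ (o k l)ᶜ ∩ (o l k)ᶜ)`.

Proof (same architecture as the landed PE, `…MesoPairExpansion`, with a different pull-out).
* `|β k| ≤ B` a.e. (`ae_bdd_abs_condExp_of_ae_bdd_abs`), so `|ξ k| ≤ 2B` a.e.; `ξ k`, `U k`, `ξ k ξ l`, `U k U l`
  are integrable.
* `∫ (Σ U)² = Σ_k Σ_l ∫ U k U l` (`Finset.sum_mul_sum`, `integral_finsetSum`).
* Each pair is split pointwise by `1 = a + (1 − a) b + (1 − a)(1 − b)`, `a = 1_{o k l}`, `b = 1_{o l k}`.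
* Ordered pieces (`pe2_ordered_bound`): `U k U l a = Y (ξ k ξ l)` with `Y = w k · w l · a` `mA k l`-measurable and
  `|Y| ≤ 1_{v k ∩ v l ∩ o k l}`; the pull-out property (`condExp_mul_of_stronglyMeasurable_left`, `integral_condExp`)
  gives `∫ Y (ξ k ξ l) = ∫ Y μ[ξ k ξ l | mA k l]`, whence `|∫ U k U l a| ≤ ∫ 1_{v k ∩ v l ∩ o k l} |μ[ξ k ξ l | mA k l]|`;
  the piece `(1 − a) b` is the same with the roles of `k, l` exchanged (σ-algebra `mA l k`, product `ξ l ξ k`), and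
  `Finset.sum_comm` identifies the two totals.
* Unordered piece (`pe2_unordered_bound`): `|U k U l (1 − a)(1 − b)| ≤ 4B² 1_{v k ∩ v l ∩ (o k l)ᶜ ∩ (o l k)ᶜ}`.
* Bookkeeping of the double sums: `pe2_skeleton`.
-/

noncomputable section

open MeasureTheory Set Filter Topology
open scoped ENNReal Classical

namespace Summit.AtomisticToContinuum.HydrodynamicLimit.Theorems.KickFairRelEquilibriumMesoLine

open Literature.Analysis.FluidPDE Literature.MathematicalPhysics.KineticTheory

section PE2

variable {Ω : Type*} {m0 : MeasurableSpace Ω} {μ : Measure Ω}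

/-! ## Pointwise inequalities -/

/-- The indicator of a set with value `1` is at most `1`. [folklore] -/
private theorem pe2_indicator_le_one (S : Set Ω) (x : Ω) : S.indicator (fun _ => (1 : ℝ)) x ≤ 1 :=
  Set.indicator_apply_le' (fun _ => le_rfl) (fun _ => zero_le_one)

/-- `|1 - 1_S| ≤ 1`. [folklore] -/
private theorem pe2_abs_one_sub_indicator_le (S : Set Ω) (x : Ω) :
    |1 - S.indicator (fun _ => (1 : ℝ)) x| ≤ 1 := by
  by_cases hx : x ∈ S
  · simp [Set.indicator_of_mem hx]
  · simp [Set.indicator_of_notMem hx]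

/-- **Pointwise bound of the ordered weight**: with `|wk| ≤ 1_{vk}`, `|wl| ≤ 1_{vl}`, `|e| ≤ 1`:
`|wk wl (e 1_s)| ≤ 1_{vk ∩ vl ∩ s}`. [folklore] -/
private theorem pe2_pt_weight {wk wl e : ℝ} {x : Ω} {vk vl s : Set Ω}
    (hwk : |wk| ≤ vk.indicator (fun _ => (1 : ℝ)) x) (hwl : |wl| ≤ vl.indicator (fun _ => (1 : ℝ)) x)
    (he : |e| ≤ 1) :
    |wk * wl * (e * s.indicator (fun _ => (1 : ℝ)) x)| ≤ (vk ∩ vl ∩ s).indicator (fun _ => (1 : ℝ)) x := by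
  by_cases hx : x ∈ vk ∩ vl ∩ s
  · rw [Set.indicator_of_mem hx]
    obtain ⟨⟨hxk, hxl⟩, hxs⟩ := hx
    simp only [Set.indicator_of_mem hxk] at hwk
    simp only [Set.indicator_of_mem hxl] at hwl
    simp only [Set.indicator_of_mem hxs, mul_one]
    rw [abs_mul, abs_mul]
    have h1 : |wk| * |wl| ≤ 1 * 1 := mul_le_mul hwk hwl (abs_nonneg _) zero_le_one
    have h2 : |wk| * |wl| * |e| ≤ 1 * 1 * 1 := mul_le_mul h1 he (abs_nonneg _) (by positivity)
    linarith
  · rw [Set.indicator_of_notMem hx]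
    simp only [Set.mem_inter_iff, not_and_or] at hx
    rcases hx with (hxk | hxl) | hxs
    · simp only [Set.indicator_of_notMem hxk] at hwk
      have : wk = 0 := abs_nonpos_iff.mp hwk
      simp [this]
    · simp only [Set.indicator_of_notMem hxl] at hwl
      have : wl = 0 := abs_nonpos_iff.mp hwl
      simp [this]
    · simp [Set.indicator_of_notMem hxs]

/-- **Pointwise bound of the unordered term**: with `|wk| ≤ 1_{vk}`, `|wl| ≤ 1_{vl}`, `|xk|, |xl| ≤ 2B`:
`|wk xk (wl xl) (1 − 1_s)(1 − 1_t)| ≤ 4B² 1_{vk ∩ vl ∩ sᶜ ∩ tᶜ}`. [folklore] -/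
private theorem pe2_pt_unordered {wk wl xk xl B : ℝ} {x : Ω} {vk vl s t : Set Ω} (hB : 0 ≤ B)
    (hwk : |wk| ≤ vk.indicator (fun _ => (1 : ℝ)) x) (hwl : |wl| ≤ vl.indicator (fun _ => (1 : ℝ)) x)
    (hxk : |xk| ≤ 2 * B) (hxl : |xl| ≤ 2 * B) :
    |wk * xk * (wl * xl) *
        ((1 - s.indicator (fun _ => (1 : ℝ)) x) * (1 - t.indicator (fun _ => (1 : ℝ)) x))| ≤
      4 * B ^ 2 * (vk ∩ vl ∩ sᶜ ∩ tᶜ).indicator (fun _ => (1 : ℝ)) x := by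
  by_cases hx : x ∈ vk ∩ vl ∩ sᶜ ∩ tᶜ
  · rw [Set.indicator_of_mem hx, mul_one]
    obtain ⟨⟨⟨hxk', hxl'⟩, hxs⟩, hxt⟩ := hx
    simp only [Set.indicator_of_mem hxk'] at hwk
    simp only [Set.indicator_of_mem hxl'] at hwl
    simp only [Set.indicator_of_notMem hxs, Set.indicator_of_notMem hxt, sub_zero, mul_one]
    rw [abs_mul, abs_mul, abs_mul]
    have h1 : |wk| * |xk| ≤ 1 * (2 * B) := mul_le_mul hwk hxk (abs_nonneg _) zero_le_one
    have h2 : |wl| * |xl| ≤ 1 * (2 * B) := mul_le_mul hwl hxl (abs_nonneg _) zero_le_one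
    have h3 : |wk| * |xk| * (|wl| * |xl|) ≤ 1 * (2 * B) * (1 * (2 * B)) :=
      mul_le_mul h1 h2 (by positivity) (by positivity)
    nlinarith
  · rw [Set.indicator_of_notMem hx, mul_zero]
    simp only [Set.mem_inter_iff, not_and_or, Set.mem_compl_iff, not_not] at hx
    rcases hx with ((hxk' | hxl') | hxs) | hxt
    · simp only [Set.indicator_of_notMem hxk'] at hwk
      have : wk = 0 := abs_nonpos_iff.mp hwk
      simp [this]
    · simp only [Set.indicator_of_notMem hxl'] at hwl
      have : wl = 0 := abs_nonpos_iff.mp hwl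
      simp [this]
    · simp [Set.indicator_of_mem hxs]
    · simp [Set.indicator_of_mem hxt]

/-! ## The pull-out property on the join and the two integral bounds -/

/-- **Ordered-pair bound (pull-out on the join).** If `mA ≤ m0`, `Y` is `mA`-strongly measurable with
`|Y| ≤ 1_S` for a measurable `S`, and `F` is integrable, then `∫ Y F = ∫ Y μ[F|mA]`
(`condExp_mul_of_stronglyMeasurable_left`, `integral_condExp`), whence `|∫ Y F| ≤ ∫ 1_S |μ[F|mA]|`. [folklore] -/
private theorem pe2_ordered_bound [IsFiniteMeasure μ] {mA : MeasurableSpace Ω} (hA : mA ≤ m0)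
    {Y F : Ω → ℝ} (hY : StronglyMeasurable[mA] Y) {S : Set Ω} (hS : MeasurableSet[m0] S)
    (hYb : ∀ x, |Y x| ≤ S.indicator (fun _ => (1 : ℝ)) x) (hF : Integrable F μ) :
    |∫ x, Y x * F x ∂μ| ≤ ∫ x, S.indicator (fun _ => (1 : ℝ)) x * |(μ[F|mA]) x| ∂μ := by
  have hYm0 : AEStronglyMeasurable[m0] Y μ := (hY.mono hA).aestronglyMeasurable
  have hYn : ∀ᵐ x ∂μ, ‖Y x‖ ≤ 1 := ae_of_all _ fun x => by
    rw [Real.norm_eq_abs]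
    exact (hYb x).trans (pe2_indicator_le_one S x)
  have hYF : Integrable (fun x => Y x * F x) μ := hF.bdd_mul hYm0 hYn
  have key : ∫ x, Y x * F x ∂μ = ∫ x, Y x * (μ[F|mA]) x ∂μ := by
    have h1 : μ[Y * F|mA] =ᵐ[μ] Y * μ[F|mA] := condExp_mul_of_stronglyMeasurable_left hY hYF hF
    have h2 : ∫ x, (μ[Y * F|mA]) x ∂μ = ∫ x, (Y * F) x ∂μ := integral_condExp hA
    calc ∫ x, Y x * F x ∂μ = ∫ x, (Y * F) x ∂μ := rfl
      _ = ∫ x, (μ[Y * F|mA]) x ∂μ := h2.symm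
      _ = ∫ x, (Y * μ[F|mA]) x ∂μ := integral_congr_ae h1
      _ = ∫ x, Y x * (μ[F|mA]) x ∂μ := rfl
  rw [key]
  have hind0 : ∀ x, 0 ≤ S.indicator (fun _ => (1 : ℝ)) x := fun x =>
    Set.indicator_nonneg (fun _ _ => zero_le_one) x
  have hint : Integrable (fun x => S.indicator (fun _ => (1 : ℝ)) x * |(μ[F|mA]) x|) μ := by
    refine integrable_condExp.abs.bdd_mul (c := 1)
      (stronglyMeasurable_const.indicator hS).aestronglyMeasurable (ae_of_all _ fun x => ?_)
    rw [Real.norm_eq_abs, abs_of_nonneg (hind0 x)]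
    exact pe2_indicator_le_one S x
  calc |∫ x, Y x * (μ[F|mA]) x ∂μ|
      ≤ ∫ x, |Y x * (μ[F|mA]) x| ∂μ := abs_integral_le_integral_abs
    _ ≤ ∫ x, S.indicator (fun _ => (1 : ℝ)) x * |(μ[F|mA]) x| ∂μ := by
        refine integral_mono_of_nonneg (ae_of_all _ fun x => abs_nonneg _) hint ?_
        filter_upwards with x
        rw [abs_mul]
        exact mul_le_mul_of_nonneg_right (hYb x) (abs_nonneg _)

/-- **Unordered-pair bound.** If `|F| ≤ C 1_S` a.e. for a measurable `S`, then `|∫ F| ≤ C μ(S)`. [folklore] -/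
private theorem pe2_unordered_bound [IsFiniteMeasure μ] {F : Ω → ℝ} {C : ℝ} {S : Set Ω}
    (hS : MeasurableSet S) (hF : ∀ᵐ x ∂μ, |F x| ≤ C * S.indicator (fun _ => (1 : ℝ)) x) :
    |∫ x, F x ∂μ| ≤ C * μ.real S := by
  have hint : Integrable (fun x => C * S.indicator (fun _ => (1 : ℝ)) x) μ :=
    ((integrable_const (1 : ℝ)).indicator hS).const_mul C
  calc |∫ x, F x ∂μ| ≤ ∫ x, |F x| ∂μ := abs_integral_le_integral_abs
    _ ≤ ∫ x, C * S.indicator (fun _ => (1 : ℝ)) x ∂μ :=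
        integral_mono_of_nonneg (ae_of_all _ fun x => abs_nonneg _) hint hF
    _ = C * μ.real S := by
        rw [integral_const_mul, integral_indicator_const _ hS, smul_eq_mul, mul_one]

/-! ## Bookkeeping of the double sum -/

/-- **Skeleton of the pair expansion PE″.** For integrable products `U k U l`, `{0,1}`-valued measurable `a k l`,
and per-pair bounds of the three pieces `a k l`, `(1 − a k l) a l k`, `(1 − a k l)(1 − a l k)` of each product
by `X k l`, `X l k`, `4B² M k l`: `∫ (Σ U)² ≤ 2 ΣΣ X + 4B² ΣΣ M`. [folklore] -/
private theorem pe2_skeleton {K : Type*} [Fintype K] {U : K → Ω → ℝ} {a : K → K → Ω → ℝ}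
    {X M : K → K → ℝ} {B : ℝ}
    (hUU : ∀ k l, Integrable (fun x => U k x * U l x) μ)
    (ha : ∀ k l, AEStronglyMeasurable (a k l) μ) (ha01 : ∀ k l x, a k l x = 0 ∨ a k l x = 1)
    (hTA : ∀ k l, |∫ x, U k x * U l x * a k l x ∂μ| ≤ X k l)
    (hTB : ∀ k l, |∫ x, U k x * U l x * ((1 - a k l x) * a l k x) ∂μ| ≤ X l k)
    (hTC : ∀ k l, |∫ x, U k x * U l x * ((1 - a k l x) * (1 - a l k x)) ∂μ| ≤ 4 * B ^ 2 * M k l) :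
    ∫ x, (∑ k, U k x) ^ 2 ∂μ ≤ 2 * ∑ k, ∑ l, X k l + 4 * B ^ 2 * ∑ k, ∑ l, M k l := by
  -- integrability of the three pieces of each pair
  have hn1 : ∀ k l x, ‖a k l x‖ ≤ 1 := fun k l x => by
    rcases ha01 k l x with h | h <;> simp [h]
  have hn2 : ∀ k l x, ‖(1 - a k l x) * a l k x‖ ≤ 1 := fun k l x => by
    rcases ha01 k l x with h | h <;> rcases ha01 l k x with h' | h' <;> simp [h, h']
  have hn3 : ∀ k l x, ‖(1 - a k l x) * (1 - a l k x)‖ ≤ 1 := fun k l x => by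
    rcases ha01 k l x with h | h <;> rcases ha01 l k x with h' | h' <;> simp [h, h']
  have hI1 : ∀ k l, Integrable (fun x => U k x * U l x * a k l x) μ := fun k l =>
    (hUU k l).mul_bdd (ha k l) (ae_of_all _ (hn1 k l))
  have hI2 : ∀ k l, Integrable (fun x => U k x * U l x * ((1 - a k l x) * a l k x)) μ := by
    intro k l
    have hg : AEStronglyMeasurable (fun x => (1 - a k l x) * a l k x) μ :=
      (aestronglyMeasurable_const.sub (ha k l)).mul (ha l k)
    exact (hUU k l).mul_bdd hg (ae_of_all _ (hn2 k l))
  have hI3 : ∀ k l, Integrable (fun x => U k x * U l x * ((1 - a k l x) * (1 - a l k x))) μ := by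
    intro k l
    have hg : AEStronglyMeasurable (fun x => (1 - a k l x) * (1 - a l k x)) μ :=
      (aestronglyMeasurable_const.sub (ha k l)).mul (aestronglyMeasurable_const.sub (ha l k))
    exact (hUU k l).mul_bdd hg (ae_of_all _ (hn3 k l))
  -- the split of each pair
  have hsplit : ∀ k l, ∫ x, U k x * U l x ∂μ =
      ∫ x, U k x * U l x * a k l x ∂μ + ∫ x, U k x * U l x * ((1 - a k l x) * a l k x) ∂μ +
        ∫ x, U k x * U l x * ((1 - a k l x) * (1 - a l k x)) ∂μ := by
    intro k l
    have h12 : Integrable (fun x => U k x * U l x * a k l x +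
        U k x * U l x * ((1 - a k l x) * a l k x)) μ := (hI1 k l).add (hI2 k l)
    rw [← integral_add (hI1 k l) (hI2 k l), ← integral_add h12 (hI3 k l)]
    refine integral_congr_ae (ae_of_all _ fun x => ?_)
    ring
  -- swapping the summation identifies the two ordered totals
  have hcomm : ∑ k, ∑ l, X l k = ∑ k, ∑ l, X k l := Finset.sum_comm
  calc ∫ x, (∑ k, U k x) ^ 2 ∂μ = ∫ x, ∑ k, ∑ l, U k x * U l x ∂μ := by
        refine integral_congr_ae (ae_of_all _ fun x => ?_)
        beta_reduce
        rw [sq, Finset.sum_mul_sum]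
    _ = ∑ k, ∑ l, ∫ x, U k x * U l x ∂μ := by
        rw [integral_finsetSum _ fun k _ => integrable_finsetSum _ fun l _ => hUU k l]
        exact Finset.sum_congr rfl fun k _ => integral_finsetSum _ fun l _ => hUU k l
    _ ≤ ∑ k, ∑ l, (X k l + X l k + 4 * B ^ 2 * M k l) := by
        refine Finset.sum_le_sum fun k _ => Finset.sum_le_sum fun l _ => ?_
        rw [hsplit k l]
        exact add_le_add (add_le_add ((le_abs_self _).trans (hTA k l))
          ((le_abs_self _).trans (hTB k l))) ((le_abs_self _).trans (hTC k l))
    _ = 2 * ∑ k, ∑ l, X k l + 4 * B ^ 2 * ∑ k, ∑ l, M k l := by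
        simp only [Finset.sum_add_distrib, ← Finset.mul_sum, hcomm]
        ring

end PE2

/-! ## The registered sub-goal -/

/-- **PE″ — the abstract pair expansion with the pull-out on the join** (registered sub-goal
`stub_pairExpansion2` of the line `condition-the-past`): on a finite measure space, for finitely many
conditionally centred, weighted, a.e.-bounded integrable outcomes,
`∫ (Σ_k w_k (D_k − μ[D_k | m k]))² dμ ≤ 2 Σ_k Σ_l ∫ 1_{v k ∩ v l ∩ o k l} |μ[(D k − μ[D k|m k])(D l − μ[D l|m l]) | mA k l]| dμ`
`+ 4B² Σ_k Σ_l μ(v k ∩ v l ∩ (o k l)ᶜ ∩ (o l k)ᶜ)`: expand the square, split each pair into its two ordered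
pieces and the unordered one, pull the bounded `mA`-measurable weight `w k · w l · 1_{o}` out of the conditional
expectation of the PRODUCT of the two centred outcomes on the ordered pieces, and count the unordered ones. [folklore] -/
theorem stub_pairExpansion2 : PairExpansion2 := by
  intro Ω m0 μ _ K _ m mA D w v o B hB hm hmA hmk hml hD hDb hw hv hwv ho ho'
  -- (0) elementary facts: `|β k| ≤ B` a.e., `|ξ k| ≤ 2B` a.e., integrability of `ξ k`, `ξ k ξ l`, `U k`
  have hβb : ∀ k, ∀ᵐ x ∂μ, |(μ[D k|m k]) x| ≤ B := fun k =>
    ae_bdd_abs_condExp_of_ae_bdd_abs (hDb k)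
  have hξm : ∀ k, AEStronglyMeasurable (fun x => D k x - (μ[D k|m k]) x) μ := fun k =>
    (hD k).aestronglyMeasurable.sub (stronglyMeasurable_condExp.mono (hm k)).aestronglyMeasurable
  have hξi : ∀ k, Integrable (fun x => D k x - (μ[D k|m k]) x) μ := fun k =>
    (hD k).sub integrable_condExp
  have hξb : ∀ k, ∀ᵐ x ∂μ, |D k x - (μ[D k|m k]) x| ≤ 2 * B := fun k => by
    filter_upwards [hDb k, hβb k] with x h1 h2
    exact (abs_sub _ _).trans (by linarith)
  have hξn : ∀ k, ∀ᵐ x ∂μ, ‖D k x - (μ[D k|m k]) x‖ ≤ 2 * B := fun k =>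
    (hξb k).mono fun x hx => by rw [Real.norm_eq_abs]; exact hx
  have hFF : ∀ k l, Integrable (fun x => (D k x - (μ[D k|m k]) x) * (D l x - (μ[D l|m l]) x)) μ :=
    fun k l => (hξi l).bdd_mul (hξm k) (hξn k)
  have hUm : ∀ k, AEStronglyMeasurable (fun x => w k x * (D k x - (μ[D k|m k]) x)) μ := fun k =>
    ((hw k).mono (hm k)).aestronglyMeasurable.mul (hξm k)
  have hUb : ∀ k, ∀ᵐ x ∂μ, ‖w k x * (D k x - (μ[D k|m k]) x)‖ ≤ 2 * B := fun k => by
    filter_upwards [hξb k] with x h1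
    rw [Real.norm_eq_abs, abs_mul]
    have h3 : |w k x| ≤ 1 := (hwv k x).trans (pe2_indicator_le_one _ x)
    calc |w k x| * |D k x - (μ[D k|m k]) x| ≤ 1 * (2 * B) :=
          mul_le_mul h3 h1 (abs_nonneg _) zero_le_one
      _ = 2 * B := one_mul _
  have hUi : ∀ k, Integrable (fun x => w k x * (D k x - (μ[D k|m k]) x)) μ := fun k =>
    Integrable.of_bound (hUm k) (2 * B) (hUb k)
  refine pe2_skeleton (μ := μ) (U := fun k x => w k x * (D k x - (μ[D k|m k]) x))
    (a := fun k l x => (o k l).indicator (fun _ => (1 : ℝ)) x)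
    (X := fun k l => ∫ x, (v k ∩ v l ∩ o k l).indicator (fun _ => (1 : ℝ)) x *
      |(μ[(fun x => (D k x - (μ[D k | m k]) x) * (D l x - (μ[D l | m l]) x)) | mA k l]) x| ∂μ)
    (M := fun k l => μ.real (v k ∩ v l ∩ (o k l)ᶜ ∩ (o l k)ᶜ)) (B := B) ?_ ?_ ?_ ?_ ?_ ?_
  · -- integrability of the pair products
    intro k l
    exact (hUi l).bdd_mul (hUm k) (hUb k)
  · -- measurability of the order indicators
    intro k l
    exact (stronglyMeasurable_const.indicator (hmA k l _ (ho k l))).aestronglyMeasurable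
  · -- the order indicators are `{0,1}`-valued
    intro k l x
    by_cases hx : x ∈ o k l
    · exact Or.inr (Set.indicator_of_mem hx _)
    · exact Or.inl (Set.indicator_of_notMem hx _)
  · -- TA: `k` before `l`; pull `Y = w k · w l · 1_{o k l}` out of `μ[ξ k ξ l | mA k l]`
    intro k l
    have hYm : StronglyMeasurable[mA k l] (fun x => w k x * w l x *
        (1 * (o k l).indicator (fun _ => (1 : ℝ)) x)) :=
      (((hw k).mono (hmk k l)).mul ((hw l).mono (hml k l))).mul
        (stronglyMeasurable_const.mul (stronglyMeasurable_const.indicator (ho k l)))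
    have hYb : ∀ x, |w k x * w l x * (1 * (o k l).indicator (fun _ => (1 : ℝ)) x)| ≤
        (v k ∩ v l ∩ o k l).indicator (fun _ => (1 : ℝ)) x := fun x =>
      pe2_pt_weight (hwv k x) (hwv l x) abs_one.le
    have hS : MeasurableSet[m0] (v k ∩ v l ∩ o k l) :=
      ((hm k _ (hv k)).inter (hm l _ (hv l))).inter (hmA k l _ (ho k l))
    have key := pe2_ordered_bound (hmA k l) hYm hS hYb (hFF k l)
    refine Eq.trans_le ?_ key
    congr 1
    refine integral_congr_ae (ae_of_all _ fun x => ?_)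
    ring
  · -- TB: `l` before `k`; pull `Y = w l · w k · (1 − 1_{o k l}) 1_{o l k}` out of `μ[ξ l ξ k | mA l k]`
    intro k l
    have hYm : StronglyMeasurable[mA l k] (fun x => w l x * w k x *
        ((1 - (o k l).indicator (fun _ => (1 : ℝ)) x) * (o l k).indicator (fun _ => (1 : ℝ)) x)) :=
      (((hw l).mono (hmk l k)).mul ((hw k).mono (hml l k))).mul
        ((stronglyMeasurable_const.sub (stronglyMeasurable_const.indicator (ho' l k))).mul
          (stronglyMeasurable_const.indicator (ho l k)))
    have hYb : ∀ x, |w l x * w k x *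
        ((1 - (o k l).indicator (fun _ => (1 : ℝ)) x) * (o l k).indicator (fun _ => (1 : ℝ)) x)| ≤
          (v l ∩ v k ∩ o l k).indicator (fun _ => (1 : ℝ)) x := fun x =>
      pe2_pt_weight (hwv l x) (hwv k x) (pe2_abs_one_sub_indicator_le _ x)
    have hS : MeasurableSet[m0] (v l ∩ v k ∩ o l k) :=
      ((hm l _ (hv l)).inter (hm k _ (hv k))).inter (hmA l k _ (ho l k))
    have key := pe2_ordered_bound (hmA l k) hYm hS hYb (hFF l k)
    refine Eq.trans_le ?_ key
    congr 1
    refine integral_congr_ae (ae_of_all _ fun x => ?_)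
    ring
  · -- TC: the unordered piece is bounded by `4B²` times its event
    intro k l
    have hS : MeasurableSet[m0] (v k ∩ v l ∩ (o k l)ᶜ ∩ (o l k)ᶜ) :=
      (((hm k _ (hv k)).inter (hm l _ (hv l))).inter (hmA k l _ (ho k l)).compl).inter
        (hmA k l _ (ho' k l)).compl
    refine pe2_unordered_bound hS ?_
    filter_upwards [hξb k, hξb l] with x h1 h2
    exact pe2_pt_unordered hB (hwv k x) (hwv l x) h1 h2

end Summit.AtomisticToContinuum.HydrodynamicLimit.Theorems.KickFairRelEquilibriumMesoLine

end
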